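import Mathlib

/-!
# Integral reproducing kernel on a window (stub `stub_integralKernel`)

Crux item stmt-Langlands-8485, route `CapacityClassicality`, line `Sketch-ideate-r1-k1`, RESHAPE 16 (§ T),
registered stub T4 `stub_integralKernel`: the maximal-minor trick that turns the single-form `v`-adic
sup-norm Sturm principle on a window into an integral reproducing kernel.

Let `E` be a field with a ring homomorphism `v : E →+* ℚ̄_p` (any ultrametric normed field will do),
`V ⊆ E⟦σ⟧` an `E`-subspace of multivariable power series and `W` a finite window of exponents such that
for every `A ∈ V` the maximum of `‖v (coeff x A)‖` over `x ∈ W` bounds `‖v (coeff y A)‖` for every `y`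
(hypothesis `hW`).  Then for every exponent `m` there are weights `κ : (σ →₀ ℕ) → E` with
`‖v (κ x)‖ ≤ 1` and `coeff m A = ∑_{x ∈ W} κ x · coeff x A` for all `A ∈ V`.

## Proof

`hW` with bound `0` shows that an element of `V` vanishing on the window vanishes, so `V` embeds in
`E^W`, is finite-dimensional, and the window functionals `coeff x|_V` (`x ∈ W`) span the dual `V*`.
The statement is then the case `D = V*`, `u x = coeff x|_V`, `ψ = coeff m|_V` of the abstract lemma
`ikr_exists_integral_combination` (the hypothesis on `ψ` is `hW` transported through `V ≃ V**`):
in a finite-dimensional space `D` spanned by `u x` (`x ∈ W`), a vector `ψ` such that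
`‖v (g ψ)‖ ≤ max_{x ∈ W} ‖v (g (u x))‖` for every functional `g` is a `v`-integral combination of the
`u x`.  For the latter fix a reference basis `e` of `D` (`n = dim D`), choose columns
`c₀ : Fin n → W` maximising `‖v (det_e (u ∘ c₀))‖` — some such determinant is non-zero because the `u x`
span `D`, so the maximal one is non-zero and `u ∘ c₀` is a basis — and expand `ψ` in this basis by
Cramer's rule (`Basis.det_smul_mk_coord_eq_det_update`): the `j`-th coordinate is
`det_e (u ∘ c₀ with column j replaced by ψ) / det_e (u ∘ c₀)`.  The numerator is the value at `ψ` of the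
linear functional "determinant with the `j`-th column replaced", whose values at the `u x`, `x ∈ W`, are
determinants of competitors of `c₀`, hence bounded by the denominator; by the domination hypothesis so
is its value at `ψ`, i.e. the coordinate is `v`-integral.  Summing the coordinates over the fibres of
`c₀` gives `κ` (integral by the ultrametric inequality).  Only Mathlib is used.
-/

set_option linter.dupNamespace false

noncomputable section

namespace Summit.Langlands.Langlands.Theorems.HilbertIntegralOverconvergentIsCongruence

open scoped NumberField
open Module

/-- **Maximal-minor / Cramer lemma.** Let `D` be a finite-dimensional `E`-vector space spanned by
the vectors `u x`, `x ∈ W` (`W` finite), let `v : E →+* L` be a ring homomorphism into an ultrametric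
normed field, and let `ψ : D` be dominated by the window in the sense that every linear functional `g`
on `D` satisfies `‖v (g ψ)‖ ≤ B` as soon as `‖v (g (u x))‖ ≤ B` for all `x ∈ W`.  Then
`ψ = ∑_{x ∈ W} κ x • u x` with `v`-integral coefficients, `‖v (κ x)‖ ≤ 1`.  Proof: choose columns
`c₀ : Fin n → W` maximising `‖v (det_e (u ∘ c₀))‖` for a reference basis `e` (a non-zero such minor
exists because the `u x` span `D`), expand `ψ` in the basis `u ∘ c₀` by Cramer's rule, and bound each
Cramer numerator by the denominator via the domination hypothesis applied to the functional
"determinant with the `j`-th column replaced". [folklore] -/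
theorem ikr_exists_integral_combination {E L D ι : Type*} [Field E] [NormedField L]
    [IsUltrametricDist L] [AddCommGroup D] [Module E D] [FiniteDimensional E D]
    (v : E →+* L) (u : ι → D) (ψ : D) (W : Finset ι)
    (hspan : Submodule.span E (Set.range fun x : W => u x) = ⊤)
    (hψ : ∀ g : Module.Dual E D, ∀ B : ℝ, 0 ≤ B → (∀ x ∈ W, ‖v (g (u x))‖ ≤ B) → ‖v (g ψ)‖ ≤ B) :
    ∃ κ : ι → E, (∀ x, ‖v (κ x)‖ ≤ 1) ∧ ψ = ∑ x ∈ W, κ x • u x := by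
  classical
  rcases W.eq_empty_or_nonempty with rfl | hWne
  · refine ⟨0, fun _ => by simp, ?_⟩
    rw [Finset.sum_empty, ← Module.forall_dual_apply_eq_zero_iff E ψ]
    intro g
    have h := hψ g 0 le_rfl (by simp)
    exact (map_eq_zero v).1 (norm_le_zero_iff.1 h)
  haveI : Nonempty W := hWne.coe_sort
  set n := Module.finrank E D
  let e : Basis (Fin n) E D := Module.finBasis E D
  let uW : W → D := fun x => u x
  let Dd : (Fin n → W) → E := fun c => e.det (uW ∘ c)
  obtain ⟨c₀, hmax⟩ := Finite.exists_max fun c => ‖v (Dd c)‖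
  -- a non-vanishing maximal minor exists
  have hex : ∃ c : Fin n → W, Dd c ≠ 0 := by
    obtain ⟨κ', a, -, hsp, hli⟩ := exists_linearIndependent' E uW
    rw [hspan] at hsp
    let b : Basis κ' E D := Basis.mk hli hsp.ge
    by_contra! h
    have hzero : (e.det : MultilinearMap E (fun _ : Fin n => D) E) = 0 := by
      refine Basis.ext_multilinear (fun _ => b) fun w => ?_
      simpa [b, Dd, Function.comp_def] using h (a ∘ w)
    have h1 : (e.det : MultilinearMap E (fun _ : Fin n => D) E) e = 0 := by rw [hzero]; rfl
    rw [AlternatingMap.coe_multilinearMap, e.det_self] at h1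
    exact one_ne_zero h1
  obtain ⟨c₁, hc₁⟩ := hex
  have hne : Dd c₀ ≠ 0 := by
    intro h0
    have h1 := hmax c₁
    rw [h0, map_zero, norm_zero] at h1
    exact hc₁ ((map_eq_zero v).1 (norm_le_zero_iff.1 h1))
  -- Cramer's rule in the basis `uW ∘ c₀`
  obtain ⟨hli, hsp⟩ := (e.is_basis_iff_det).2 (isUnit_iff_ne_zero.2 hne)
  let B₀ : Basis (Fin n) E D := Basis.mk hli hsp.ge
  let g : Fin n → Module.Dual E D := fun j => e.det.toMultilinearMap.toLinearMap (uW ∘ c₀) j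
  have hg : ∀ j (y : D), g j y = e.det (Function.update (uW ∘ c₀) j y) := fun j y => by
    simp [g]
  let q : Fin n → E := fun j => g j ψ / Dd c₀
  have hrepr : ∀ j, B₀.repr ψ j = q j := by
    intro j
    have h := congrArg (fun f : D →ₗ[E] E => f ψ) (e.det_smul_mk_coord_eq_det_update hli hsp.ge j)
    simp only [LinearMap.smul_apply, Basis.coord_apply, smul_eq_mul] at h
    show B₀.repr ψ j = g j ψ / Dd c₀
    rw [eq_div_iff hne, mul_comm]
    exact h
  have hqbound : ∀ j, ‖v (q j)‖ ≤ 1 := by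
    intro j
    have hpos : 0 < ‖v (Dd c₀)‖ := norm_pos_iff.2 ((map_ne_zero v).2 hne)
    show ‖v (g j ψ / Dd c₀)‖ ≤ 1
    rw [map_div₀, norm_div, div_le_one hpos]
    refine hψ (g j) _ (norm_nonneg _) fun x hx => ?_
    have hupd : g j (u x) = Dd (Function.update c₀ j ⟨x, hx⟩) := by
      rw [hg]
      show _ = e.det (uW ∘ Function.update c₀ j ⟨x, hx⟩)
      rw [Function.comp_update]
    rw [hupd]
    exact hmax _
  refine ⟨fun x => ∑ j, if (c₀ j : ι) = x then q j else 0, fun x => ?_, ?_⟩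
  · rw [map_sum]
    refine IsUltrametricDist.norm_sum_le_of_forall_le_of_nonneg zero_le_one fun j _ => ?_
    split_ifs
    · exact hqbound j
    · simp
  · calc ψ = ∑ j, B₀.repr ψ j • B₀ j := (B₀.sum_repr ψ).symm
      _ = ∑ j, q j • u (c₀ j) := by
          refine Finset.sum_congr rfl fun j _ => ?_
          rw [hrepr]
          simp [B₀, uW]
      _ = ∑ j, ∑ x ∈ W, (if (c₀ j : ι) = x then q j else 0) • u x := by
          refine Finset.sum_congr rfl fun j _ => ?_
          simp only [ite_zero_smul, Finset.sum_ite_eq, Finset.coe_mem, if_true]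
      _ = ∑ x ∈ W, (∑ j, if (c₀ j : ι) = x then q j else 0) • u x := by
          rw [Finset.sum_comm]; simp only [Finset.sum_smul]

/-- **Integral reproducing kernel on the window** (stub T4 of line `Sketch-ideate-r1-k1`).  If on the
`E`-subspace `V` of `q`-expansions the `v`-adic maximum over the finite window `W` bounds every coefficient
(the single-form sup-norm Sturm principle `hW`), then every coefficient functional `coeff m` agrees on `V`
with a combination `∑_{x ∈ W} κ x · coeff x` whose weights are `v`-integral, `‖v (κ x)‖ ≤ 1`.  Proof: `hW`
with `B = 0` makes the window restriction injective on `V` (so `V` is finite-dimensional and the window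
functionals span its dual); then apply the maximal-minor / Cramer lemma
`ikr_exists_integral_combination` in the dual of `V`, transporting `hW` through the evaluation
isomorphism `V ≃ V**`. [folklore] -/
theorem stub_integralKernel {E σ : Type} [Field E] (p : ℕ) [Fact p.Prime] (v : E →+* PadicAlgCl p)
    (V : Submodule E (MvPowerSeries σ E)) (W : Finset (σ →₀ ℕ))
    (hW : ∀ A ∈ V, ∀ B : ℝ, 0 ≤ B → (∀ x ∈ W, ‖v (MvPowerSeries.coeff x A)‖ ≤ B) →
      ∀ x, ‖v (MvPowerSeries.coeff x A)‖ ≤ B) (m : σ →₀ ℕ) :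
    ∃ κ : (σ →₀ ℕ) → E, (∀ x, ‖v (κ x)‖ ≤ 1) ∧
      ∀ A ∈ V, MvPowerSeries.coeff m A = ∑ x ∈ W, κ x * MvPowerSeries.coeff x A := by
  classical
  -- an element of `V` vanishing on the window vanishes
  have hzero : ∀ A ∈ V, (∀ x ∈ W, MvPowerSeries.coeff x A = 0) → A = 0 := by
    intro A hA h0
    ext y
    have h := hW A hA 0 le_rfl (fun x hx => by simp [h0 x hx]) y
    simpa using h
  -- the window functionals on `V`
  let φ : (σ →₀ ℕ) → Module.Dual E V := fun x => (MvPowerSeries.coeff x).comp V.subtype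
  -- `V` is finite-dimensional: the window restriction is injective
  let res : V →ₗ[E] (W → E) := LinearMap.pi fun x : W => φ x
  have hres : Function.Injective res := by
    rw [injective_iff_map_eq_zero]
    intro A hA
    have h : ∀ x ∈ W, MvPowerSeries.coeff x (A : MvPowerSeries σ E) = 0 := fun x hx =>
      congr_fun hA ⟨x, hx⟩
    exact Subtype.ext (hzero A A.2 h)
  haveI : FiniteDimensional E V := FiniteDimensional.of_injective res hres
  -- the window functionals span the dual of `V`
  have hspan : Submodule.span E (Set.range fun x : W => φ x) = ⊤ := by
    apply Submodule.span_eq_top_of_ne_zero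
    intro z hz
    by_contra! h
    exact hz (Subtype.ext (hzero z z.2 fun x hx => h (φ x) ⟨⟨x, hx⟩, rfl⟩))
  obtain ⟨κ, hκ, hsum⟩ := ikr_exists_integral_combination v φ (φ m) W hspan (fun g B hB hgW => by
    set A := (Module.evalEquiv E V).symm g
    have hA : ∀ x, g (φ x) = MvPowerSeries.coeff x (A : MvPowerSeries σ E) := fun x => by
      rw [← Module.apply_evalEquiv_symm_apply E V (φ x) g]
      rfl
    rw [hA]
    exact hW _ A.2 B hB (fun x hx => hA x ▸ hgW x hx) m)
  refine ⟨κ, hκ, fun A hA => ?_⟩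
  have h := congrArg (fun f : Module.Dual E V => f ⟨A, hA⟩) hsum
  simpa [φ] using h

end Summit.Langlands.Langlands.Theorems.HilbertIntegralOverconvergentIsCongruence

end
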